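/-
search for candidate a priori estimates; no regularity claim

# K80 — (R26) THE SECOND-VARIATION LAWS AT EVERY CROSSING POINT (rotating test vector)

Node of record (verbatim, unchanged): L-λ(q) =
`Summit.NavierStokesRegularity.FunctionalMining.TopEigHeatCoercivePos q := ∃ c > 0,`
`TopEigHeatCoercive q c` — OPEN for every real `q > 1`; (F2) killing family WANTED/OPEN. This
file proves NECESSARY CONDITIONS at EVERY point — so at every CROSSING point `λ₂ = λ₁`,
interior or not — of a smooth field on `T^d` with `S ≤ m` everywhere and a top vector
`S(x)e = m e`; an exact (F2) witness on `T³` (`heatDissipation Φ_q v ≤ 0`, `Φ_q v > 0`; frozen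
top `λ₁ ≡ m > 0`, K57b) is such a field at every point (§ 3). It constructs none, excludes none
and decides no node. K79 (R25) needed INTERIOR crossing points, K77 (R23) simple points; (R26)
is the law in between. THE ONE FUNCTION: `G(t) = (e + tw)ᵀS(x + ta)(e + tw) − m|e + tw|² ≤ 0 =
G(0)` for every direction `a` and every ROTATION `w` of the test vector, so `G′(0) = 0`,
`G″(0) ≤ 0`. With `Sₖ := S(∂ₖv)(x)`, `Sⱼₖ := S(∂ⱼ∂ₖv)(x)`: (R26a) `eᵀSₖe = 0`, polarised (R26a′)
CROSS LAW `fᵀSₖe = 0` for ANY two top vectors (`dot_strainDeriv_eq_zero`); (R26b) `Σ aⱼaₖ eᵀSⱼₖe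
+ 4 Σ aₖ wᵀSₖe + 2 wᵀS(x)w ≤ 2m|w|²` (`secondVar_le`; `w = 0` is K78 (R24b)). At a point with the
biaxial identity (BI) `S(x)² + mS(x) = 2m²·1` (K79 `CrossInt.strain_sq_add_smul_eq`: EVERY
crossing point of a trace-free `3 × 3` strain; here the hypothesis `hBI`): (R26c) BOTTOM LAW
`S(x)(Sₖe) = −2m Sₖe` (`mulVec_strainDeriv_eq`); (R26d) GRAM INEQUALITY `3m Σ aⱼaₖ eᵀSⱼₖe ≤
−2|Σ aₖSₖe|²` (`gram_le`); (R26e) `3m eᵀS(Δv)e + 2 Σₖ|Sₖe|² ≤ 0` (`laplacian_le`); (R26f) VECTOR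
LAW: a top `e` with `eᵀS(Δv)(x)e = 0` (K78 (R24d/e): one at every point of an exact witness;
hypotheses `hflat` / `hμ`) has `Sₖe = 0` for all `k` (`strainDeriv_mulVec_eq_zero`,
`exists_topVec_vector_law_of_exact`). HONEST PLACEMENT: second-order perturbation of a degenerate
top eigenvalue under a one-sided bound, typed director-free; one application of the one-variable
second-derivative test. No number of record moves. [ours; § 0 folklore]
FILING (prove seat g33, REQUEST #110 v3, GRANT LEAD (59ac) INBOX l.5893): declarations byte-identical to the prove-cut `pub-nsfunc-prove/staged/g33-filings/TopEigHeatSecondVariation.v3.lean` 9997de481af20870 (= nogo K80 v2 0c06ceb771a95a18 mechanically dedup-restaged per (59z)/(59ab), DELTA `K80v3-DELTA.md`); this line is the only addition.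
-/
import Summits.NavierStokesRegularity.FunctionalMining.NoGo.TopEigHeatIsoTopLow
import Summits.NavierStokesRegularity.FunctionalMining.NoGo.TopEigHeatFlatTop
import Summits.NavierStokesRegularity.FunctionalMining.NoGo.TopEigHeatCrossingInterior
import Summits.NavierStokesRegularity.FunctionalMining.StrainBlockTilt
import Summits.NavierStokesRegularity.FunctionalMining.TopEigDensityIdentity
import Summits.NavierStokesRegularity.FunctionalMining.TopEigDanskin
import Summits.NavierStokesRegularity.FunctionalMining.BiaxialXRay
import Literature.Analysis.PDE.ParabolicMaximumPrinciple1D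
import HarnessLib

noncomputable section

open Filter Topology Set Matrix

namespace Summit.NavierStokesRegularity.FunctionalMining

open Literature.Analysis Literature.Analysis.FunctionSpaces Literature.Analysis.FunctionSpaces.Torus
  Literature.Analysis.FluidPDE StrainL4 SharpClass.DirectorForm

namespace TopEig.SecondVar

/-! ## 0. Tools -/

section Tools

variable {d : Type*} [Fintype d] [DecidableEq d] {v : UnitAddTorus d → EuclideanSpace ℝ d}

omit [DecidableEq d] in
/-- Rayleigh numerator of the rotating test vector `e + t w` (`M` symmetric). [folklore] -/
theorem dot_mulVec_add_smul {M : Matrix d d ℝ} (hM : M.IsSymm) (e w : d → ℝ) (t : ℝ) :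
    (e + t • w) ⬝ᵥ M *ᵥ (e + t • w) =
      e ⬝ᵥ M *ᵥ e + 2 * t * (w ⬝ᵥ M *ᵥ e) + t * t * (w ⬝ᵥ M *ᵥ w) := by
  have hs : e ⬝ᵥ M *ᵥ w = w ⬝ᵥ M *ᵥ e := by
    rw [TopEig.CrossInt.dot_mulVec_comm_of_isSymm hM e w, dotProduct_comm]
  simp only [Matrix.mulVec_add, Matrix.mulVec_smul, add_dotProduct, dotProduct_add,
    smul_dotProduct, dotProduct_smul, smul_eq_mul, hs]
  ring

omit [DecidableEq d] in
/-- `|e + t w|² = |e|² + 2t (w·e) + t² |w|²`. [folklore] -/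
theorem dot_add_smul_self (e w : d → ℝ) (t : ℝ) :
    (e + t • w) ⬝ᵥ (e + t • w) = e ⬝ᵥ e + 2 * t * (w ⬝ᵥ e) + t * t * (w ⬝ᵥ w) := by
  simp only [add_dotProduct, dotProduct_add, smul_dotProduct, dotProduct_smul, smul_eq_mul,
    dotProduct_comm e w]
  ring

omit [DecidableEq d] in
/-- `uᵀ M w = Σ_{(i,j)} uᵢ wⱼ Mᵢⱼ`. [folklore] -/
theorem dot_mulVec_eq_sum_prod (M : Matrix d d ℝ) (u w : d → ℝ) :
    u ⬝ᵥ M *ᵥ w = ∑ p : d × d, u p.1 * w p.2 * M p.1 p.2 := by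
  simp only [dotProduct, Matrix.mulVec, Fintype.sum_prod_type, Finset.mul_sum]
  exact Finset.sum_congr rfl fun i _ => Finset.sum_congr rfl fun j _ => by ring

/-- `Σⱼ (εₐ)ⱼ • V j = V a`. [folklore] -/
theorem sum_single_smul (a : d) (V : d → d → ℝ) :
    ∑ j, (EuclideanSpace.single a (1 : ℝ)) j • V j = V a := by
  simp [PiLp.single_apply, ite_smul, Finset.sum_ite_eq']

/-- `t ↦ S(v)(x + t a)ᵢⱼ` has derivative `Σₖ aₖ S(∂ₖv)(x + t a)ᵢⱼ` (`hasDerivAt_line`). -/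
theorem hasDerivAt_strainEntry_line (hv : Torus.IsSmooth v) (x : UnitAddTorus d)
    (a : EuclideanSpace ℝ d) (i j : d) (s : ℝ) :
    HasDerivAt (fun t : ℝ => torusStrainMatrix v (x + proj (t • a)) i j)
      (∑ k, a k * torusStrainMatrix (Torus.partialDeriv k v) (x + proj (s • a)) i j) s := by
  have h := isSmooth_torusStrainMatrix_entry hv i j
  refine (BiaxialEikonal.hasDerivAt_line h x a s).congr_deriv ?_
  rw [fderiv_apply_eq_sum_partialDeriv (h.isContDiff (by simp))]
  exact Finset.sum_congr rfl fun k _ => by rw [partialDeriv_strainEntry hv k i j, smul_eq_mul]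

/-- `t ↦ uᵀ S(v)(x + t a) w` has derivative `Σₖ aₖ uᵀ S(∂ₖv)(x + t a) w`. [folklore] -/
theorem hasDerivAt_dotStrain_line (hv : Torus.IsSmooth v) (u w : d → ℝ) (x : UnitAddTorus d)
    (a : EuclideanSpace ℝ d) (s : ℝ) :
    HasDerivAt (fun t : ℝ => u ⬝ᵥ torusStrainMatrix v (x + proj (t • a)) *ᵥ w)
      (∑ k, a k * (u ⬝ᵥ torusStrainMatrix (Torus.partialDeriv k v) (x + proj (s • a)) *ᵥ w)) s := by
  simp only [dot_mulVec_eq_sum_prod]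
  refine (HasDerivAt.fun_sum fun p _ =>
    (hasDerivAt_strainEntry_line hv x a p.1 p.2 s).const_mul (u p.1 * w p.2)).congr_deriv ?_
  simp only [Finset.mul_sum]
  rw [Finset.sum_comm]
  exact Finset.sum_congr rfl fun k _ => Finset.sum_congr rfl fun p _ => by ring

/-- **Second-derivative test for the rotating-vector combination**: if `F(t) = p + 2t q + t² r`
has a local maximum at `0`, then `p″(0) + 4 q′(0) + 2 r(0) ≤ 0`. [folklore] -/
theorem combo_secondDeriv_nonpos {p q r p' q' r' : ℝ → ℝ} {p'' q'' r'' : ℝ}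
    (hp : ∀ t, HasDerivAt p (p' t) t) (hq : ∀ t, HasDerivAt q (q' t) t)
    (hr : ∀ t, HasDerivAt r (r' t) t) (hp' : HasDerivAt p' p'' 0) (hq' : HasDerivAt q' q'' 0)
    (hr' : HasDerivAt r' r'' 0)
    (hmax : IsLocalMax (fun t => p t + 2 * t * q t + t * t * r t) 0) :
    p'' + 4 * q' 0 + 2 * r 0 ≤ 0 := by
  have h2 : ∀ t : ℝ, HasDerivAt (fun y : ℝ => 2 * y) 2 t := fun t => by
    simpa using (hasDerivAt_id' t).const_mul (2 : ℝ)
  have hsq : ∀ t : ℝ, HasDerivAt (fun y : ℝ => y * y) (t + t) t := fun t =>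
    ((hasDerivAt_id' t).mul (hasDerivAt_id' t)).congr_deriv (by ring)
  have hid2 : HasDerivAt (fun y : ℝ => y + y) (1 + 1) 0 := (hasDerivAt_id' (0 : ℝ)).add
    (hasDerivAt_id' 0)
  refine Literature.Analysis.PDE.deriv_deriv_nonpos_of_isLocalMax hmax
    (f' := fun t => p' t + (2 * q t + 2 * t * q' t) + ((t + t) * r t + t * t * r' t))
    (f'' := p'' + 4 * q' 0 + 2 * r 0) (Filter.Eventually.of_forall fun t => ?_) ?_
  · exact (((hp t).add ((h2 t).mul (hq t))).add ((hsq t).mul (hr t))).congr_deriv (by ring)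
  · exact ((hp'.add (((hq 0).const_mul 2).add ((h2 0).mul hq'))).add
      ((hid2.mul (hr 0)).add ((hsq 0).mul hr'))).congr_deriv (by ring)

end Tools

/-! ## 1. (R26a/b) First and second variation for a top vector of a field with `S ≤ m` -/

section Variation

variable {d : Type*} [Fintype d] [DecidableEq d] {v : UnitAddTorus d → EuclideanSpace ℝ d}
  {x : UnitAddTorus d} {m : ℝ} {e f : d → ℝ} (hv : Torus.IsSmooth v)
  (hle : ∀ y u, u ⬝ᵥ torusStrainMatrix v y *ᵥ u ≤ m * (u ⬝ᵥ u))
  (he : torusStrainMatrix v x *ᵥ e = m • e)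
include hv hle he

/-- **(R26a) FIRST VARIATION `eᵀ S(∂ₖv)(x) e = 0`** for a top vector `S(x)e = m e`, `S ≤ m`. -/
theorem dot_strainDeriv_self_eq_zero (k : d) :
    e ⬝ᵥ torusStrainMatrix (Torus.partialDeriv k v) x *ᵥ e = 0 := by
  have h0 : e ⬝ᵥ torusStrainMatrix v x *ᵥ e = m * (e ⬝ᵥ e) := by
    rw [he, dotProduct_smul, smul_eq_mul]
  have hmax : IsLocalMax (fun t : ℝ =>
      e ⬝ᵥ torusStrainMatrix v (x + proj (t • EuclideanSpace.single k (1 : ℝ))) *ᵥ e) 0 :=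
    Filter.Eventually.of_forall fun t => by
      simp only [zero_smul, proj_zero, add_zero, h0]
      exact hle _ e
  have h := hmax.hasDerivAt_eq_zero (hasDerivAt_dotStrain_line hv e e x _ 0)
  simpa only [zero_smul, proj_zero, add_zero, TopEig.FlatTop.sum_single_mul] using h

/-- **(R26a′) POLARISED CROSS LAW `fᵀ S(∂ₖv)(x) e = 0`** for ANY two top vectors at `x` ((R26a)
for `e`, `f`, `e + f`); K79 (R25d) with no interior hypothesis and no `m ≠ 0`. [ours] -/
theorem dot_strainDeriv_eq_zero (hf : torusStrainMatrix v x *ᵥ f = m • f) (k : d) :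
    f ⬝ᵥ torusStrainMatrix (Torus.partialDeriv k v) x *ᵥ e = 0 := by
  have hef : torusStrainMatrix v x *ᵥ (e + f) = m • (e + f) := by
    rw [Matrix.mulVec_add, he, hf, smul_add]
  have h1 := dot_strainDeriv_self_eq_zero hv hle he k
  have h2 := dot_strainDeriv_self_eq_zero hv hle hf k
  have h3 := dot_strainDeriv_self_eq_zero hv hle hef k
  rw [Matrix.mulVec_add, add_dotProduct, dotProduct_add, dotProduct_add, h1, h2,
    TopEig.CrossInt.dot_mulVec_comm_of_isSymm (torusStrainMatrix_isSymm _ _) e f,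
    dotProduct_comm] at h3
  linarith

/-- **(R26b) SECOND VARIATION with a rotating test vector**: for every direction `a` and `w`,
`Σ aₖaⱼ eᵀS(∂ⱼ∂ₖv)(x)e + 4 Σ aₖ wᵀS(∂ₖv)(x)e + 2 wᵀS(x)w ≤ 2m|w|²` (`w = 0`: K78 (R24b)). [ours] -/
theorem secondVar_le (a : EuclideanSpace ℝ d) (w : d → ℝ) :
    ∑ k, a k * ∑ j, a j *
        (e ⬝ᵥ torusStrainMatrix (Torus.partialDeriv j (Torus.partialDeriv k v)) x *ᵥ e) +
      4 * ∑ k, a k * (w ⬝ᵥ torusStrainMatrix (Torus.partialDeriv k v) x *ᵥ e) +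
        2 * (w ⬝ᵥ torusStrainMatrix v x *ᵥ w) ≤ 2 * m * (w ⬝ᵥ w) := by
  have h0 : e ⬝ᵥ torusStrainMatrix v x *ᵥ e = m * (e ⬝ᵥ e) := by
    rw [he, dotProduct_smul, smul_eq_mul]
  have hmax : IsLocalMax (fun t : ℝ =>
      (e ⬝ᵥ torusStrainMatrix v (x + proj (t • a)) *ᵥ e - m * (e ⬝ᵥ e)) +
      2 * t * (w ⬝ᵥ torusStrainMatrix v (x + proj (t • a)) *ᵥ e - m * (w ⬝ᵥ e)) +
      t * t * (w ⬝ᵥ torusStrainMatrix v (x + proj (t • a)) *ᵥ w - m * (w ⬝ᵥ w))) 0 :=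
    Filter.Eventually.of_forall fun t => by
      have h1 := hle (x + proj (t • a)) (e + t • w)
      rw [dot_mulVec_add_smul (torusStrainMatrix_isSymm v _), dot_add_smul_self] at h1
      simp only [zero_smul, proj_zero, add_zero, mul_zero, zero_mul, h0]
      linarith
  have h := combo_secondDeriv_nonpos
    (fun t => (hasDerivAt_dotStrain_line hv e e x a t).sub_const _)
    (fun t => (hasDerivAt_dotStrain_line hv w e x a t).sub_const _)
    (fun t => (hasDerivAt_dotStrain_line hv w w x a t).sub_const _)
    (HasDerivAt.fun_sum fun k _ =>
      (hasDerivAt_dotStrain_line (hv.partialDeriv k) e e x a 0).const_mul (a k))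
    (HasDerivAt.fun_sum fun k _ =>
      (hasDerivAt_dotStrain_line (hv.partialDeriv k) w e x a 0).const_mul (a k))
    (HasDerivAt.fun_sum fun k _ =>
      (hasDerivAt_dotStrain_line (hv.partialDeriv k) w w x a 0).const_mul (a k)) hmax
  simp only [zero_smul, proj_zero, add_zero] at h
  linarith

end Variation

/-! ## 2. (R26c–f) At a point with the biaxial identity (BI) `S(x)² + mS(x) = 2m²·1` -/

section Biaxial

variable {d : Type*} [Fintype d] [DecidableEq d] {v : UnitAddTorus d → EuclideanSpace ℝ d}
  {x : UnitAddTorus d} {m : ℝ} {e : d → ℝ} (hv : Torus.IsSmooth v)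
  (hle : ∀ y u, u ⬝ᵥ torusStrainMatrix v y *ᵥ u ≤ m * (u ⬝ᵥ u))
  (he : torusStrainMatrix v x *ᵥ e = m • e)
include hv hle he

/-- **(R26c) BOTTOM LAW `S(x)(Sₖe) = −2m·Sₖe`** at ANY point with (BI): `(S + 2m)z` is top for
every `z`, so (R26a′) gives `zᵀ(S + 2m)(Sₖe) = 0` (K79 (R25a), no interior hypothesis). [ours]
≠ `TopEig.CrossInt.mulVec_mulVec_strainDeriv_eq`: that needs (BI) on a neighbourhood of `x`;
this needs (BI) at `x` plus the global top bound `hle`. -/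
theorem mulVec_strainDeriv_eq
    (hBI : torusStrainMatrix v x * torusStrainMatrix v x + m • torusStrainMatrix v x =
      (2 * m ^ 2) • (1 : Matrix d d ℝ)) (k : d) :
    torusStrainMatrix v x *ᵥ (torusStrainMatrix (Torus.partialDeriv k v) x *ᵥ e) =
      (-(2 * m)) • (torusStrainMatrix (Torus.partialDeriv k v) x *ᵥ e) := by
  set u := torusStrainMatrix (Torus.partialDeriv k v) x *ᵥ e with hu
  have htop : ∀ z, torusStrainMatrix v x *ᵥ (torusStrainMatrix v x *ᵥ z + (2 * m) • z) =
      m • (torusStrainMatrix v x *ᵥ z + (2 * m) • z) := by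
    intro z
    have h := congrArg (fun M => M *ᵥ z) hBI
    simp only [Matrix.add_mulVec, ← Matrix.mulVec_mulVec, Matrix.smul_mulVec,
      Matrix.one_mulVec] at h
    rw [Matrix.mulVec_add, Matrix.mulVec_smul]
    funext i
    have hi := congrFun h i
    simp only [Pi.add_apply, Pi.smul_apply, smul_eq_mul] at hi ⊢
    linear_combination hi
  have hz : ∀ z, z ⬝ᵥ (torusStrainMatrix v x *ᵥ u + (2 * m) • u) = 0 := by
    intro z
    have h := dot_strainDeriv_eq_zero hv hle he (htop z) k
    rw [add_dotProduct, smul_dotProduct, smul_eq_mul,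
      ← TopEig.CrossInt.dot_mulVec_comm_of_isSymm (torusStrainMatrix_isSymm v x) z u] at h
    rw [dotProduct_add, dotProduct_smul, smul_eq_mul]
    exact h
  have h0 := hz (torusStrainMatrix v x *ᵥ u + (2 * m) • u)
  rw [dotProduct_self_eq_zero, add_eq_zero_iff_eq_neg, ← neg_smul] at h0
  exact h0

variable (hBI : torusStrainMatrix v x * torusStrainMatrix v x + m • torusStrainMatrix v x =
    (2 * m ^ 2) • (1 : Matrix d d ℝ))
include hBI

/-- **(R26d) GRAM INEQUALITY `3m · Σₖ aₖ Σⱼ aⱼ eᵀS(∂ⱼ∂ₖv)(x)e ≤ −2 |Σₖ aₖ S(∂ₖv)(x)e|²`** (`m > 0`;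
(R26b) along `3m·a` with `w = Σₖ aₖ Sₖe`, and (R26c)): the inequality half of K79 (R25b). [ours] -/
theorem gram_le (hm : 0 < m) (a : EuclideanSpace ℝ d) :
    3 * m * ∑ k, a k * ∑ j, a j *
        (e ⬝ᵥ torusStrainMatrix (Torus.partialDeriv j (Torus.partialDeriv k v)) x *ᵥ e) +
      2 * ((∑ k, a k • torusStrainMatrix (Torus.partialDeriv k v) x *ᵥ e) ⬝ᵥ
        (∑ k, a k • torusStrainMatrix (Torus.partialDeriv k v) x *ᵥ e)) ≤ 0 := by
  set u := ∑ k, a k • torusStrainMatrix (Torus.partialDeriv k v) x *ᵥ e with hu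
  set H := ∑ k, a k * ∑ j, a j *
    (e ⬝ᵥ torusStrainMatrix (Torus.partialDeriv j (Torus.partialDeriv k v)) x *ᵥ e) with hH
  have hSu : torusStrainMatrix v x *ᵥ u = (-(2 * m)) • u := by
    simp only [hu, ← Matrix.mulVecLin_apply, map_sum, map_smul]
    simp only [Matrix.mulVecLin_apply, mulVec_strainDeriv_eq hv hle he hBI, smul_smul,
      Finset.smul_sum]
    exact Finset.sum_congr rfl fun k _ => by rw [mul_comm]
  have h1 : ∑ k, a k * (u ⬝ᵥ torusStrainMatrix (Torus.partialDeriv k v) x *ᵥ e) = u ⬝ᵥ u := by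
    rw [hu, dotProduct_sum]
    exact Finset.sum_congr rfl fun k _ => by rw [dotProduct_smul, smul_eq_mul]
  have hHc : ∑ k, ((3 * m) • a) k * ∑ j, ((3 * m) • a) j *
      (e ⬝ᵥ torusStrainMatrix (Torus.partialDeriv j (Torus.partialDeriv k v)) x *ᵥ e) =
      3 * m * (3 * m) * H := by
    simp only [PiLp.smul_apply, smul_eq_mul, hH, Finset.mul_sum]
    exact Finset.sum_congr rfl fun k _ => Finset.sum_congr rfl fun j _ => by ring
  have hBc : ∑ k, ((3 * m) • a) k * (u ⬝ᵥ torusStrainMatrix (Torus.partialDeriv k v) x *ᵥ e) =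
      3 * m * (u ⬝ᵥ u) := by
    rw [← h1, Finset.mul_sum]
    exact Finset.sum_congr rfl fun k _ => by rw [PiLp.smul_apply, smul_eq_mul, mul_assoc]
  have hW : u ⬝ᵥ torusStrainMatrix v x *ᵥ u = -(2 * m) * (u ⬝ᵥ u) := by
    rw [hSu, dotProduct_smul, smul_eq_mul]
  have h := secondVar_le hv hle he ((3 * m) • a) u
  rw [hHc, hBc, hW] at h
  have key : 3 * m * (3 * m * H + 2 * (u ⬝ᵥ u)) ≤ 0 := by linarith
  nlinarith [key, hm]

/-- **(R26e) LAPLACIAN INEQUALITY `3m · eᵀS(Δv)(x)e + 2 Σₖ |S(∂ₖv)(x)e|² ≤ 0`** ((R26d) on the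
coordinate directions): `eᵀS(Δv)e ≤ 0` is KINEMATIC at every crossing point (K79 (R25b′)). [ours] -/
theorem laplacian_le (hm : 0 < m) :
    3 * m * (e ⬝ᵥ torusStrainMatrix (Torus.laplacian v) x *ᵥ e) +
      2 * ∑ k, (torusStrainMatrix (Torus.partialDeriv k v) x *ᵥ e) ⬝ᵥ
        (torusStrainMatrix (Torus.partialDeriv k v) x *ᵥ e) ≤ 0 := by
  have hM : torusStrainMatrix (Torus.laplacian v) x =
      ∑ k, torusStrainMatrix (Torus.partialDeriv k (Torus.partialDeriv k v)) x := by
    ext i j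
    rw [Matrix.sum_apply, torusStrainMatrix_laplacian hv x i j]
  have hk : ∀ k : d,
      3 * m * (e ⬝ᵥ torusStrainMatrix (Torus.partialDeriv k (Torus.partialDeriv k v)) x *ᵥ e) +
      2 * ((torusStrainMatrix (Torus.partialDeriv k v) x *ᵥ e) ⬝ᵥ
        (torusStrainMatrix (Torus.partialDeriv k v) x *ᵥ e)) ≤ 0 := by
    intro k
    have h := gram_le hv hle he hBI hm (EuclideanSpace.single k 1)
    simp only [TopEig.FlatTop.sum_single_mul, sum_single_smul] at h
    exact h
  rw [hM, Matrix.sum_mulVec, dotProduct_sum, Finset.mul_sum, Finset.mul_sum,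
    ← Finset.sum_add_distrib]
  exact Finset.sum_nonpos fun k _ => hk k

/-- **(R26f) VECTOR LAW AT EVERY CROSSING POINT**: a top vector with `eᵀS(Δv)(x)e = 0` at a
point with (BI) is killed by the strain of every derivative field: `S(∂ₖv)(x)e = 0`. [ours] -/
theorem strainDeriv_mulVec_eq_zero (hm : 0 < m)
    (hflat : e ⬝ᵥ torusStrainMatrix (Torus.laplacian v) x *ᵥ e = 0) (k : d) :
    torusStrainMatrix (Torus.partialDeriv k v) x *ᵥ e = 0 := by
  have h := laplacian_le hv hle he hBI hm
  rw [hflat, mul_zero, zero_add] at h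
  have hs : ∑ k, (torusStrainMatrix (Torus.partialDeriv k v) x *ᵥ e) ⬝ᵥ
      (torusStrainMatrix (Torus.partialDeriv k v) x *ᵥ e) = 0 :=
    le_antisymm (by linarith) (Finset.sum_nonneg fun k _ => dotProduct_self_nonneg' _)
  exact dotProduct_self_eq_zero.mp
    ((Finset.sum_eq_zero_iff_of_nonneg fun k _ => dotProduct_self_nonneg' _).mp hs k
      (Finset.mem_univ k))

end Biaxial

/-! ## 3. Exact (F2) witnesses on `T³`: the laws at every (crossing) point -/

section Exact

variable {v : UnitAddTorus (Fin 3) → EuclideanSpace ℝ (Fin 3)} {q : ℝ} {x : UnitAddTorus (Fin 3)}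
  {e f : Fin 3 → ℝ}

variable (hq : 1 < q) (hv : Torus.IsSmooth v) (hdv : Torus.IsDivFree v)
  (hT : heatDissipation (torusTopEigMoment q) v ≤ 0) (hΦ : 0 < torusTopEigMoment q v)
include hq hv hdv hT hΦ

/-- **`S ≤ λ₁(x)` everywhere** for an exact witness: `uᵀS(y)u ≤ λ₁(x)|u|²` (frozen top). [ours] -/
theorem dot_mulVec_le_of_exact (y : UnitAddTorus (Fin 3)) (u : Fin 3 → ℝ) :
    u ⬝ᵥ torusStrainMatrix v y *ᵥ u ≤ torusStrainTopEig v x * (u ⬝ᵥ u) := by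
  rw [← (TopEig.CrossInt.topEig_pos_and_const hq hv hdv hT hΦ y).2, ← lam_strainFlat,
    ← flat_torusStrainMatrix, ← quad_flat]
  exact quad_le_lam_mul _ u

/-- **(R26a′) for exact witnesses, at EVERY point**: `fᵀS(∂ₖv)(x)e = 0` for two top vectors. -/
theorem cross_law_of_exact (he : e ∈ topEigSet (strainFlat v x))
    (hf : f ∈ topEigSet (strainFlat v x)) (k : Fin 3) :
    f ⬝ᵥ torusStrainMatrix (Torus.partialDeriv k v) x *ᵥ e = 0 :=
  dot_strainDeriv_eq_zero hv (dot_mulVec_le_of_exact hq hv hdv hT hΦ)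
    (TopEig.CrossInt.mulVec_eq_smul_of_mem_topEigSet he)
    (TopEig.CrossInt.mulVec_eq_smul_of_mem_topEigSet hf) k

variable (hBI :
  torusStrainMatrix v x * torusStrainMatrix v x + torusStrainTopEig v x • torusStrainMatrix v x =
    (2 * torusStrainTopEig v x ^ 2) • (1 : Matrix (Fin 3) (Fin 3) ℝ))
include hBI

/-- **(R26f) for exact witnesses at a crossing point** (`hBI` = K79 `strain_sq_add_smul_eq`): a flat
top `e` (`quad (S(Δv) x) e = 0`, K78 `exists_flat_topVec_of_exact`) has `S(∂ₖv)(x)e = 0`. [ours] -/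
theorem vector_law_of_exact (he : e ∈ topEigSet (strainFlat v x))
    (hflat : quad (strainFlat (Torus.laplacian v) x) e = 0) (k : Fin 3) :
    torusStrainMatrix (Torus.partialDeriv k v) x *ᵥ e = 0 :=
  strainDeriv_mulVec_eq_zero hv (dot_mulVec_le_of_exact hq hv hdv hT hΦ)
    (TopEig.CrossInt.mulVec_eq_smul_of_mem_topEigSet he) hBI
    (TopEig.CrossInt.topEig_pos_and_const hq hv hdv hT hΦ x).1
    (by rwa [← flat_torusStrainMatrix, quad_flat] at hflat) k

/-- **(R26f) from `μ(x) = 0`** at a crossing point (K78 `dirTopEig_laplacian_eq_zero_of_exact`: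
`μ ≡ 0`): some top vector is killed by every `S(∂ₖv)(x)`; with K77 this covers EVERY point. -/
theorem exists_topVec_vector_law_of_exact
    (hμ : dirTopEig (strainFlat v x) (strainFlat (Torus.laplacian v) x) = 0) :
    ∃ e ∈ topEigSet (strainFlat v x),
      ∀ k, torusStrainMatrix (Torus.partialDeriv k v) x *ᵥ e = 0 := by
  obtain ⟨e, he, h⟩ :=
    exists_quad_eq_dirTopEig (strainFlat v x) (strainFlat (Torus.laplacian v) x)
  exact ⟨e, he, vector_law_of_exact hq hv hdv hT hΦ hBI he (h.trans hμ)⟩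

end Exact

end TopEig.SecondVar

end Summit.NavierStokesRegularity.FunctionalMining

end
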